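import Summits.HodgeConjecture.HodgeConjecture.Theorems.R90S4OneDimBaseChange          -- ★ p861888 `oneDimG` (= `IrrClass.mk (SmoothIrrep.ofChar θ hθ)`, `abbrev`); brings ★ `SmoothIrrep.ofChar`, ★ `cmDatum`
import Summits.HodgeConjecture.HodgeConjecture.Theorems.R90S4SplitFormGL               -- ★ p862018 `splitFormGL` (the quasi-split form of record as a unit; `↑(splitFormGL L) = splitForm L 3`, `rfl`)
import Summits.HodgeConjecture.HodgeConjecture.Theorems.F0P3cStCharTSGqsNoncompact      -- ★ `noncompactSpace_gqs_quotient_center` (`U(Φ₃)(L⁺_v) ⧸ Z` not compact at non-split `v`); brings ★ `Gqs`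
import Literature.NumberTheory.Automorphic.MatrixCoefficientsSupercuspidal               -- ★ `Representation.not_isSupercuspidal_trivial` (`G ⧸ Z` not compact ⇒ `𝟙` not supercuspidal)
import Literature.NumberTheory.Automorphic.ParabolicInductionQuotientProofs             -- ★ `Representation.IsSupercuspidal.twist` (twisting by a smooth character preserves supercuspidality)
import HarnessLib

/-!
# R90-TF · S4 «Ch. 13.1–2», FILE C support (W3-4) C-NC — A ONE-DIMENSIONAL CLASS `⟦ℂ_θ⟧` IS NOT SUPERCUSPIDAL when `G ⧸ Z(G)` is not compact;
# in particular `⟦ψ ∘ det⟧ ∈ Irr(U(Φ₃)(L⁺_v))` is not supercuspidal at a non-split `v` (so `⟨1, ψ∘det⟩ = 1` in the kit: `{ψ∘det}` is not an A-packet)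

Cell `hodgecm-mathlib`, crux H413 (`stmt-HodgeConjecture-24833`, lane `--supports … --as helper`), route of record `HCCMUnconditional` (no route verbs;
count-neutral).  Programme R90-TF (brief `director/R90-BRIEF.v2.md` 1f40d54518340a35), section S4 = Rogawski Ch. 13.1–2 (dealer K2E2-plan (g6)); seat
R90-C10-p03 (g0), dealt BY NAME «(W3-4) C-NC `Theorems/R90S4OneDimNotSupercuspidal.lean`» (`R90/STATUS.md` 2026-09-04T21:38:39Z; frees (iii) of W3-3).
THEOREMS ONLY (no `def`, no instance, no notation, no named fact, no `sorry`); ★-only imports (three ★ `Theorems` + two ★ `Literature`); Lines-free.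
HONEST LABEL: HC_CM is proved only modulo the 7 printed citations (2 remaining named inputs: hLiu418 = stmt-HodgeConjecture-24832, h413 = stmt-HodgeConjecture-24833)
until rung 0 closes; this file is a FILE-C feeder and closes nothing global.

PRINT.  [Rogawski1990, §13.1 p. 199 l. 14]: «`Π_s(G)` = the L-packets of cardinality 1 which are not of the form `{πⁿ(ξ)}`» — the supercuspidal packets; a
one-dimensional `ψ ∘ det_G` (p. 174 (9), p. 201 Prop. 13.2.2 (b)) is never supercuspidal, because `G_v = U(3)(L⁺_v)` is not compact modulo its (compact) centre at a
non-split `v` (§3.8 p. 30), while every matrix coefficient of `ℂ_θ` is the nowhere-vanishing `g ↦ θ(g) · c`.  [HarishChandra1970, Part I §3 p. 9]: supercuspidal =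
smooth matrix coefficients compactly supported modulo the centre.

CONTENTS.
* §1 (generic topological group `G` with `G ⧸ Z(G)` NOT compact) **`not_isSupercuspidal_mk_ofChar`** — `⟦ℂ_θ⟧` (★ `SmoothIrrep.ofChar θ hθ`) is not supercuspidal:
  were `ℂ_θ = 𝟙 ⊗ θ` supercuspidal, so would be `(𝟙 ⊗ θ) ⊗ θ⁻¹ = 𝟙` (★ `IsSupercuspidal.twist`; `ker θ⁻¹ = ker θ` is open), contradicting ★ `not_isSupercuspidal_trivial`.
* §2 (CM, quasi-split form of record `Φ₃ = ↑(splitFormGL L)`, non-split `v`) `noncompactSpace_local_splitFormGL_quotient_center` — `U(Φ₃)(L⁺_v) ⧸ Z` is not compact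
  (★ `noncompactSpace_gqs_quotient_center`, read at the `splitFormGL` spelling of FILE C: `(cmDatum L 3 ↑(splitFormGL L)).Local v` IS ★ `Gqs L v` reducibly), and
  **`not_isSupercuspidal_oneDimG_splitFormGL`** — `⟦ℂ_θ⟧ = oneDimG L v (splitFormGL L) θ hθ` is not supercuspidal for EVERY smooth character `θ` of `U(Φ₃)(L⁺_v)`
  (e.g. `θ = ψ ∘ det_G`).

[cite: Rogawski1990, §13.1 p. 199; §12.2 p. 174 (9); §13.2 Prop. 13.2.2 (b) p. 201; §3.8 p. 30] [cite: HarishChandra1970, Part I §3 p. 9] [cite: BushnellHenniart2006, §10.1, §1.5]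
-/

set_option autoImplicit false
-- the mandated namespace repeats the single-problem summit's segment (`HodgeConjecture.HodgeConjecture`)
set_option linter.dupNamespace false

noncomputable section

open Literature.NumberTheory.Automorphic Literature.NumberTheory.Automorphic.UnitaryGroup
open Literature.NumberTheory.Rogawski1990
open Summit.HodgeConjecture.HodgeConjecture.Cruxes.H413

namespace Summit.HodgeConjecture.HodgeConjecture.R90.S4

universe u

/-! ## §1 Generic: `⟦ℂ_θ⟧` is not supercuspidal when `G ⧸ Z(G)` is not compact -/

section Generic

variable {G : Type u} [Group G] [TopologicalSpace G] [IsTopologicalGroup G]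

omit [TopologicalSpace G] [IsTopologicalGroup G] in
/-- `ker θ⁻¹ = ker θ` for a character `θ : G →* ℂˣ` (`θ⁻¹ g = 1 ↔ θ g = 1`). [folklore] -/
theorem ker_inv_char (θ : G →* ℂˣ) : ((θ⁻¹ : G →* ℂˣ).ker : Subgroup G) = θ.ker := by
  ext g
  simp only [MonoidHom.mem_ker, MonoidHom.inv_apply, inv_eq_one]

/-- **A ONE-DIMENSIONAL SMOOTH CLASS IS NOT SUPERCUSPIDAL WHEN `G ⧸ Z(G)` IS NOT COMPACT.**  For a character `θ : G →* ℂˣ` with open kernel, the class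
`⟦ℂ_θ⟧ = IrrClass.mk (SmoothIrrep.ofChar θ hθ)` (action `𝟙 ⊗ θ`) is not supercuspidal (★ `IrrClass.IsSupercuspidal`, Harish-Chandra's compact-support-mod-centre
condition): otherwise its twist by the smooth character `θ⁻¹` — which is the trivial character `𝟙 = (𝟙 ⊗ θ) ⊗ θ⁻¹` (★ `twist_twist`, ★ `twist_one`) — would be
supercuspidal (★ `IsSupercuspidal.twist`), contradicting ★ `not_isSupercuspidal_trivial`. [cite: HarishChandra1970, Part I §3 p. 9] [cite: BushnellHenniart2006, §10.1, §1.5] -/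
theorem not_isSupercuspidal_mk_ofChar [NoncompactSpace (G ⧸ Subgroup.center G)] (θ : G →* ℂˣ)
    (hθ : IsOpen ((θ.ker : Subgroup G) : Set G)) : ¬ (IrrClass.mk (SmoothIrrep.ofChar θ hθ)).IsSupercuspidal := by
  intro h
  -- read the class-level predicate on the representative `ℂ_θ = 𝟙 ⊗ θ` (★ `isSupercuspidal_mk`; the carrier of `ofChar` IS `ℂ`, by unfolding)
  have h0 : ((Representation.trivial ℂ G ℂ).twist θ).IsSupercuspidal := (IrrClass.isSupercuspidal_mk _).1 h
  have hker : IsOpen (((θ⁻¹ : G →* ℂˣ).ker : Subgroup G) : Set G) := by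
    rw [ker_inv_char]
    exact hθ
  -- twist back by `θ⁻¹`: `(𝟙 ⊗ θ) ⊗ θ⁻¹ = 𝟙 ⊗ (θ θ⁻¹) = 𝟙`
  have h1 := Representation.IsSupercuspidal.twist _ h0 θ⁻¹ hker
  have hθθ : θ * θ⁻¹ = 1 := MonoidHom.ext fun g => by
    simp only [MonoidHom.mul_apply, MonoidHom.inv_apply, mul_inv_cancel, MonoidHom.one_apply]
  rw [Representation.twist_twist, hθθ, Representation.twist_one] at h1
  exact Representation.not_isSupercuspidal_trivial h1

end Generic

/-! ## §2 The CM instance at the quasi-split form of record: `U(Φ₃)(L⁺_v)`, `Φ₃ = ↑(splitFormGL L)`, non-split `v` -/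

section CM

open NumberField IsDedekindDomain

variable (L : Type) [Field L] [NumberField L] [IsCMField L] (v : HeightOneSpectrum (𝓞 ↥(maximalRealSubfield L)))

/-- **`U(Φ₃)(L⁺_v) ⧸ Z` IS NOT COMPACT at a non-split `v`**, stated at FILE C's spelling `(cmDatum L 3 ↑(splitFormGL L)).Local v` of the group (which IS ★ `Gqs L v`:
`↑(splitFormGL L) = splitForm L 3 = qsForm L` reducibly) — ★ `noncompactSpace_gqs_quotient_center` (`G` not compact: the split torus `diag(t, 1, t̄⁻¹)`; `Z` compact: the
norm-one scalars). [cite: Rogawski1990, §3.8 p. 30; §4.9 p. 54] -/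
theorem noncompactSpace_local_splitFormGL_quotient_center (hv : ∀ w : PlacesOver L v, IsCMField.complexConj L • w.1 = w.1) :
    NoncompactSpace ((cmDatum L 3 (splitFormGL L : Matrix (Fin 3) (Fin 3) L)).Local v ⧸
      Subgroup.center ((cmDatum L 3 (splitFormGL L : Matrix (Fin 3) (Fin 3) L)).Local v)) :=
  F0P3cStCharTSGqsNoncompact.noncompactSpace_gqs_quotient_center L v hv

/-- **`⟦ℂ_θ⟧ ∈ Irr(U(Φ₃)(L⁺_v))` IS NOT SUPERCUSPIDAL at a non-split `v`**, for EVERY character `θ` of `U(Φ₃)(L⁺_v)` with open kernel — in particular for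
`θ = ψ ∘ det_G` (the one-dimensional packets `{ψ∘det}` of §12.2 (9) ∕ Prop. 13.2.2 (b) are not supercuspidal, so the kit weight `⟨1, ψ∘det⟩` is `1`).  §1 with §2's
non-compactness; `oneDimG L v (splitFormGL L) θ hθ` IS `IrrClass.mk (SmoothIrrep.ofChar θ hθ)` (★ `abbrev`).
[cite: Rogawski1990, §13.1 p. 199; §12.2 p. 174 (9); §13.2 Prop. 13.2.2 (b) p. 201] [cite: HarishChandra1970, Part I §3 p. 9] -/
theorem not_isSupercuspidal_oneDimG_splitFormGL (hv : ∀ w : PlacesOver L v, IsCMField.complexConj L • w.1 = w.1)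
    (θ : (cmDatum L 3 (splitFormGL L : Matrix (Fin 3) (Fin 3) L)).Local v →* ℂˣ)
    (hθ : IsOpen ((θ.ker : Subgroup ((cmDatum L 3 (splitFormGL L : Matrix (Fin 3) (Fin 3) L)).Local v)) :
      Set ((cmDatum L 3 (splitFormGL L : Matrix (Fin 3) (Fin 3) L)).Local v))) :
    ¬ (oneDimG L v (splitFormGL L) θ hθ).IsSupercuspidal :=
  haveI := noncompactSpace_local_splitFormGL_quotient_center L v hv
  not_isSupercuspidal_mk_ofChar θ hθ

end CM

end Summit.HodgeConjecture.HodgeConjecture.R90.S4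

end
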